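import Summits.QuantumFields.YangMills.Theorems.IsotropyFromPowerCountingCurvatureSandwichBoundChainEngine
import Summits.QuantumFields.YangMills.Theses.IsotropyFromPowerCounting

/-!
# `CurvatureSandwichBound` (Σ), line `Sketch`: the item ⟺ chain growth at the pair scale (axis frame ∧ 45° frame)

Support file for crux stmt-QuantumFields-18372 (`IsotropyFromPowerCounting.CurvatureSandwichBound`), registered
skeleton `Cruxes/CurvatureSandwichBound/Lines/Sketch.lean`: the closing recipe and its converse.

* `curvatureSandwichBound_of_chainGrowth`: the two registered Yang–Mills stubs (`stub_chainGrowthAxis`,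
  `stub_chainGrowthDiag`, taken here as hypotheses, verbatim) imply the item BY NAME (engine `sandwich_of_chainGrowth`
  applied to `S₁` and to its `45°` pull-back).
* `chainGrowthAxis_of_crux`, `chainGrowthDiag_of_crux`: the item implies both stubs (`chainGrowth_of_sandwich`, with
  `C_W = ‖Ψ_W‖²`).

Hence the line\'s Yang–Mills residual is equivalent to the item: nothing beyond the crux is bet, and a disprover may
attack the chain moments `Re 𝔖₁(ΘW* ⊗ P^N W)` (numbers, one window at a time) instead of an operator norm.
-/

noncomputable section

namespace Summit.QuantumFields.YangMills.Theorems.CurvatureSandwichBound.Sketch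

open scoped BigOperators SchwartzMap InnerProductSpace
open MeasureTheory Filter Topology
open Literature.MathematicalPhysics.QuantumLattice Literature.MathematicalPhysics.AQFT
  Literature.MathematicalPhysics.QuantumFieldTheory Literature.Probability.LatticeModels
open Summit.QuantumFields.YangMills.Theorems.NPointIsotropy.Negative (E4)
open Summit.QuantumFields.YangMills.Theorems.CurvatureBoostCovariance.Negative
  (OSPackage Translations Hypercubic EightFrameRP PlanarCone Tie Gaps W1)

/-! ## The converse of the engine: the sandwich rows give chain growth back -/

/-- **One chain step costs `Λ²`**: under the sandwich bound at all degrees, `‖Ψ_{PA}‖ ≤ Λ² ‖Ψ_A‖`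
(`‖Ψ_{PA}‖² = ⟨Ψ_{X(PA)}, Ψ_{XA}⟩ ≤ Λ‖Ψ_{PA}‖ · Λ‖Ψ_A‖`). -/
theorem norm_P_le (S : SchwingerFamily E4) (h : OSReconstructionNoE1 S.toLabelled)
    (u v : ℝ) (f₁ : 𝓢((Fin 1 → E4), ℂ)) (Λ : ℝ) (hΛ : 0 ≤ Λ)
    (hrow : ∀ (m : ℕ) (G : 𝓢((Fin m → E4), ℂ)) (hG : IsTimeOrdered G)
      (hXG : IsTimeOrdered (f₁.appendTensor (translateMulti ((2 * u + v) • EuclideanSpace.single 0 1) G))),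
      ‖h.fieldVec (1 + m) (fun _ => ())
          (f₁.appendTensor (translateMulti ((2 * u + v) • EuclideanSpace.single 0 1) G)) hXG‖ ≤
        Λ * ‖h.fieldVec m (fun _ => ()) G hG‖)
    (P : (Σ m : ℕ, 𝓢((Fin m → E4), ℂ)) → (Σ m : ℕ, 𝓢((Fin m → E4), ℂ)))
    (hP : P = fun Gσ => ⟨1 + (1 + Gσ.1), translateMulti ((2 * u + v) • EuclideanSpace.single 0 1)
      ((osAdjoint f₁).appendTensor
        (f₁.appendTensor (translateMulti ((2 * u + v) • EuclideanSpace.single 0 1) Gσ.2)))⟩)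
    (A : Σ m : ℕ, 𝓢((Fin m → E4), ℂ)) (hA : IsTimeOrdered A.2)
    (hXA : IsTimeOrdered (f₁.appendTensor (translateMulti ((2 * u + v) • EuclideanSpace.single 0 1) A.2)))
    (hPA : IsTimeOrdered (P A).2)
    (hXPA : IsTimeOrdered
      (f₁.appendTensor (translateMulti ((2 * u + v) • EuclideanSpace.single 0 1) (P A).2))) :
    ‖h.fieldVec (P A).1 (fun _ => ()) (P A).2 hPA‖ ≤ Λ ^ 2 * ‖h.fieldVec A.1 (fun _ => ()) A.2 hA‖ := by
  -- `P A` written out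
  have hPA_eq : P A = ⟨1 + (1 + A.1), translateMulti ((2 * u + v) • EuclideanSpace.single 0 1)
      ((osAdjoint f₁).appendTensor
        (f₁.appendTensor (translateMulti ((2 * u + v) • EuclideanSpace.single 0 1) A.2)))⟩ := by
    rw [hP]
  have hPA' : IsTimeOrdered (translateMulti ((2 * u + v) • EuclideanSpace.single 0 1)
      ((osAdjoint f₁).appendTensor
        (f₁.appendTensor (translateMulti ((2 * u + v) • EuclideanSpace.single 0 1) A.2)))) := by
    have hh := hPA
    rw [hPA_eq] at hh
    exact hh
  -- the sandwich adjoint identity with `G := (P A).2`, `G' := A.2`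
  have hsa := stub_sandwichAdjoint S h (2 * u + v) f₁ (P A).2 A.2 hPA hXPA hXA hPA'
  have hback : h.fieldVec (1 + (1 + A.1)) (fun _ => ())
      (translateMulti ((2 * u + v) • EuclideanSpace.single 0 1)
        ((osAdjoint f₁).appendTensor
          (f₁.appendTensor (translateMulti ((2 * u + v) • EuclideanSpace.single 0 1) A.2)))) hPA' =
      h.fieldVec (P A).1 (fun _ => ()) (P A).2 hPA :=
    (fieldVec_sigma_congr h hPA_eq hPA hPA').symm
  rw [hback] at hsa
  -- Schwarz + the row at the two degrees
  have key : ‖h.fieldVec (P A).1 (fun _ => ()) (P A).2 hPA‖ ^ 2 ≤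
      (Λ * ‖h.fieldVec (P A).1 (fun _ => ()) (P A).2 hPA‖) * (Λ * ‖h.fieldVec A.1 (fun _ => ()) A.2 hA‖) := by
    have h1 : ‖h.fieldVec (P A).1 (fun _ => ()) (P A).2 hPA‖ ^ 2 =
        (⟪h.fieldVec (1 + (P A).1) (fun _ => ())
            (f₁.appendTensor (translateMulti ((2 * u + v) • EuclideanSpace.single 0 1) (P A).2)) hXPA,
          h.fieldVec (1 + A.1) (fun _ => ())
            (f₁.appendTensor (translateMulti ((2 * u + v) • EuclideanSpace.single 0 1) A.2)) hXA⟫_ℂ).re := by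
      rw [hsa, ← inner_self_eq_norm_sq (𝕜 := ℂ)]
      rfl
    have h2 := re_inner_le_norm (𝕜 := ℂ)
      (h.fieldVec (1 + (P A).1) (fun _ => ())
        (f₁.appendTensor (translateMulti ((2 * u + v) • EuclideanSpace.single 0 1) (P A).2)) hXPA)
      (h.fieldVec (1 + A.1) (fun _ => ())
        (f₁.appendTensor (translateMulti ((2 * u + v) • EuclideanSpace.single 0 1) A.2)) hXA)
    rw [RCLike.re_to_complex] at h2
    rw [h1]
    exact h2.trans (mul_le_mul (hrow _ _ hPA hXPA) (hrow _ _ hA hXA) (norm_nonneg _)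
      (mul_nonneg hΛ (norm_nonneg _)))
  -- `a² ≤ (Λa)(Λb)` with `a, b ≥ 0` forces `a ≤ Λ² b`
  have ha : 0 ≤ ‖h.fieldVec (P A).1 (fun _ => ()) (P A).2 hPA‖ := norm_nonneg _
  have hb : 0 ≤ ‖h.fieldVec A.1 (fun _ => ()) A.2 hA‖ := norm_nonneg _
  generalize ‖h.fieldVec (P A).1 (fun _ => ()) (P A).2 hPA‖ = a at key ha ⊢
  generalize ‖h.fieldVec A.1 (fun _ => ()) A.2 hA‖ = b at key hb ⊢
  rcases ha.eq_or_lt with ha0 | hapos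
  · rw [← ha0]; positivity
  · have : a * a ≤ a * (Λ ^ 2 * b) := by nlinarith [key]
    exact le_of_mul_le_mul_left this hapos

/-- **`N` chain steps cost `Λ^{2N}`**: `‖Ψ_{P^N A}‖ ≤ Λ^{2N} ‖Ψ_A‖`. -/
theorem norm_iterate_le (S : SchwingerFamily E4) (h : OSReconstructionNoE1 S.toLabelled)
    (u v : ℝ) (hu : 0 < u) (hv : 0 < v) (f₁ : 𝓢((Fin 1 → E4), ℂ))
    (hf₁ : tsupport (f₁ : (Fin 1 → E4) → ℂ) ⊆ {x | u ≤ x 0 0 ∧ x 0 0 ≤ 2 * u})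
    (Λ : ℝ) (hΛ : 0 ≤ Λ)
    (hrow : ∀ (m : ℕ) (G : 𝓢((Fin m → E4), ℂ)) (hG : IsTimeOrdered G)
      (hXG : IsTimeOrdered (f₁.appendTensor (translateMulti ((2 * u + v) • EuclideanSpace.single 0 1) G))),
      ‖h.fieldVec (1 + m) (fun _ => ())
          (f₁.appendTensor (translateMulti ((2 * u + v) • EuclideanSpace.single 0 1) G)) hXG‖ ≤
        Λ * ‖h.fieldVec m (fun _ => ()) G hG‖)
    (P : (Σ m : ℕ, 𝓢((Fin m → E4), ℂ)) → (Σ m : ℕ, 𝓢((Fin m → E4), ℂ)))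
    (hP : P = fun Gσ => ⟨1 + (1 + Gσ.1), translateMulti ((2 * u + v) • EuclideanSpace.single 0 1)
      ((osAdjoint f₁).appendTensor
        (f₁.appendTensor (translateMulti ((2 * u + v) • EuclideanSpace.single 0 1) Gσ.2)))⟩)
    (N : ℕ) (A : Σ m : ℕ, 𝓢((Fin m → E4), ℂ)) (hA : IsTimeOrdered A.2)
    (hXA : IsTimeOrdered (f₁.appendTensor (translateMulti ((2 * u + v) • EuclideanSpace.single 0 1) A.2))) :
    ‖h.fieldVec (P^[N] A).1 (fun _ => ()) (P^[N] A).2 (adm_iterate' u v hu hv f₁ hf₁ P hP N A hA hXA).1‖ ≤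
      Λ ^ (2 * N) * ‖h.fieldVec A.1 (fun _ => ()) A.2 hA‖ := by
  induction N generalizing A with
  | zero => simp
  | succ N ih =>
    have hPA := adm_iterate' u v hu hv f₁ hf₁ P hP 1 A hA hXA
    calc ‖h.fieldVec (P^[N + 1] A).1 (fun _ => ()) (P^[N + 1] A).2
            (adm_iterate' u v hu hv f₁ hf₁ P hP (N + 1) A hA hXA).1‖
        = ‖h.fieldVec (P^[N] (P A)).1 (fun _ => ()) (P^[N] (P A)).2
            (adm_iterate' u v hu hv f₁ hf₁ P hP N (P A) hPA.1 hPA.2).1‖ := rfl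
      _ ≤ Λ ^ (2 * N) * ‖h.fieldVec (P A).1 (fun _ => ()) (P A).2 hPA.1‖ := ih (P A) hPA.1 hPA.2
      _ ≤ Λ ^ (2 * N) * (Λ ^ 2 * ‖h.fieldVec A.1 (fun _ => ()) A.2 hA‖) :=
          mul_le_mul_of_nonneg_left (norm_P_le S h u v f₁ Λ hΛ hrow P hP A hA hXA hPA.1 hPA.2)
            (pow_nonneg hΛ _)
      _ = Λ ^ (2 * (N + 1)) * ‖h.fieldVec A.1 (fun _ => ()) A.2 hA‖ := by ring

/-- **The converse of the engine**: the sandwich bound at all degrees gives chain growth with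
`C_W = ‖Ψ_W‖²` — so the chain-growth stubs are EQUIVALENT to the rows of the crux (nothing is bet
beyond the item). -/
theorem chainGrowth_of_sandwich (S : SchwingerFamily E4) (h : OSReconstructionNoE1 S.toLabelled)
    (u v : ℝ) (hu : 0 < u) (hv : 0 < v) (f₁ : 𝓢((Fin 1 → E4), ℂ))
    (hf₁ : tsupport (f₁ : (Fin 1 → E4) → ℂ) ⊆ {x | u ≤ x 0 0 ∧ x 0 0 ≤ 2 * u})
    (Λ : ℝ) (hΛ : 0 ≤ Λ)
    (hrow : ∀ (m : ℕ) (G : 𝓢((Fin m → E4), ℂ)) (hG : IsTimeOrdered G)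
      (hXG : IsTimeOrdered (f₁.appendTensor (translateMulti ((2 * u + v) • EuclideanSpace.single 0 1) G))),
      ‖h.fieldVec (1 + m) (fun _ => ())
          (f₁.appendTensor (translateMulti ((2 * u + v) • EuclideanSpace.single 0 1) G)) hXG‖ ≤
        Λ * ‖h.fieldVec m (fun _ => ()) G hG‖)
    (P : (Σ m : ℕ, 𝓢((Fin m → E4), ℂ)) → (Σ m : ℕ, 𝓢((Fin m → E4), ℂ)))
    (hP : P = fun Gσ => ⟨1 + (1 + Gσ.1), translateMulti ((2 * u + v) • EuclideanSpace.single 0 1)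
      ((osAdjoint f₁).appendTensor
        (f₁.appendTensor (translateMulti ((2 * u + v) • EuclideanSpace.single 0 1) Gσ.2)))⟩)
    {n : ℕ} (W : 𝓢((Fin n → E4), ℂ)) (hW : IsTimeOrdered W)
    (hFW : IsTimeOrdered
      (f₁.appendTensor (translateMulti ((2 * u + v) • EuclideanSpace.single 0 1) W))) (N : ℕ) :
    (S (n + (P^[N] ⟨n, W⟩).1) ((osAdjoint W).appendTensor (P^[N] ⟨n, W⟩).2)).re ≤
      ‖h.fieldVec n (fun _ => ()) W hW‖ ^ 2 * Λ ^ (2 * N) := by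
  have hadm := adm_iterate' u v hu hv f₁ hf₁ P hP N ⟨n, W⟩ hW hFW
  have hinner : ⟪h.fieldVec n (fun _ => ()) W hW,
      h.fieldVec (P^[N] ⟨n, W⟩).1 (fun _ => ()) (P^[N] ⟨n, W⟩).2 hadm.1⟫_ℂ =
      S (n + (P^[N] ⟨n, W⟩).1) ((osAdjoint W).appendTensor (P^[N] ⟨n, W⟩).2) :=
    h.inner_fieldVec_fieldVec (fun _ => ()) (fun _ => ()) hW hadm.1 (isAppendTensorOf_appendTensor _ _)
  have hre : (S (n + (P^[N] ⟨n, W⟩).1) ((osAdjoint W).appendTensor (P^[N] ⟨n, W⟩).2)).re ≤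
      ‖h.fieldVec n (fun _ => ()) W hW‖ *
        ‖h.fieldVec (P^[N] ⟨n, W⟩).1 (fun _ => ()) (P^[N] ⟨n, W⟩).2 hadm.1‖ := by
    rw [← hinner]
    simpa only [RCLike.re_to_complex] using re_inner_le_norm (𝕜 := ℂ)
      (h.fieldVec n (fun _ => ()) W hW) (h.fieldVec (P^[N] ⟨n, W⟩).1 (fun _ => ()) (P^[N] ⟨n, W⟩).2 hadm.1)
  have hit := norm_iterate_le S h u v hu hv f₁ hf₁ Λ hΛ hrow P hP N ⟨n, W⟩ hW hFW
  calc _ ≤ _ := hre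
    _ ≤ ‖h.fieldVec n (fun _ => ()) W hW‖ * (Λ ^ (2 * N) * ‖h.fieldVec n (fun _ => ()) W hW‖) :=
        mul_le_mul_of_nonneg_left hit (norm_nonneg _)
    _ = _ := by ring

/-! ## The item ⟺ the two chain-growth stubs -/

/-- **The closing recipe**: the two registered Yang–Mills stubs of line `Sketch` (normalised chain growth at the pair scale in
the axis frame and in the `45°` frame, taken as hypotheses verbatim) give `CurvatureSandwichBound` BY NAME, through the
engine `sandwich_of_chainGrowth` applied to `S₁` and to its `45°` pull-back (with `C_W = Re 𝔖(ΘW* ⊗ W) = ‖Ψ_W‖²`). -/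
theorem curvatureSandwichBound_of_chainGrowth
    (hAxis : ∀ (G : Type) [Group G] [TopologicalSpace G] [IsTopologicalGroup G] [CompactSpace G]
        [MeasurableSpace G] [BorelSpace G], IsCompactSimpleLieGroup G →
      ∀ (r : LatticeRep G) (sch : SpeciesScheme (YMSpecies G)) (S₁ : SchwingerFamily E4),
        W1 r sch S₁ → EightFrameRP S₁ → PlanarCone S₁ →
        (∃ (K : E4 → ℝ) (C η : ℝ), 0 < η ∧ ContinuousOn K {x : E4 | x ≠ 0} ∧
          (∀ x : E4, x ≠ 0 → |K x| ≤ C * (1 + ‖x‖ ^ (η - 10))) ∧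
          ∀ F : 𝓢((Fin 2 → E4), ℂ), IsOffDiagonal F →
            Integrable (fun x : Fin 2 → E4 => (K (x 0 - x 1) : ℂ) * F x) ∧
              S₁ 2 F = ∫ x : Fin 2 → E4, (K (x 0 - x 1) : ℂ) * F x) →
        OSReconstructionNoE1 S₁.toLabelled →
        ∃ μ C : ℝ, μ < 4 ∧ 0 ≤ C ∧
          ∀ (u v : ℝ), 0 < u → 0 < v → u ≤ 1 → v ≤ 1 →
            ∀ (f₁ : 𝓢((Fin 1 → E4), ℂ)) (g hh : ℝ × ℝ → ℂ) (Mg Mh Mh' : ℝ),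
              (∀ x : Fin 1 → E4, f₁ x = g (x 0 0, x 0 1) * hh (x 0 2, x 0 3)) →
              (∀ p : ℝ × ℝ, g p ≠ 0 → u ≤ p.1 ∧ p.1 ≤ 2 * u) →
              Integrable g → (∫ p, ‖g p‖) ≤ Mg → Integrable hh → (∫ p, ‖hh p‖) ≤ Mh →
              (∀ p, ‖hh p‖ ≤ Mh') →
            ∀ (n : ℕ) (W : 𝓢((Fin n → E4), ℂ)), IsTimeOrdered W →
              IsTimeOrdered (f₁.appendTensor (translateMulti ((2 * u + v) • EuclideanSpace.single 0 1) W)) →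
            ∀ (P : (Σ m : ℕ, 𝓢((Fin m → E4), ℂ)) → (Σ m : ℕ, 𝓢((Fin m → E4), ℂ))),
              (P = fun Gσ => ⟨1 + (1 + Gσ.1), translateMulti ((2 * u + v) • EuclideanSpace.single 0 1)
                ((osAdjoint f₁).appendTensor
                  (f₁.appendTensor (translateMulti ((2 * u + v) • EuclideanSpace.single 0 1) Gσ.2)))⟩) →
            ∀ N : ℕ,
              (S₁ (n + (P^[N] ⟨n, W⟩).1) ((osAdjoint W).appendTensor (P^[N] ⟨n, W⟩).2)).re ≤
                (S₁ (n + n) ((osAdjoint W).appendTensor W)).re *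
                  (C * Mg * (Mh + Mh') * (u ^ (-μ) + v ^ (-μ))) ^ (2 * N))
    (hDiag : ∀ (G : Type) [Group G] [TopologicalSpace G] [IsTopologicalGroup G] [CompactSpace G]
        [MeasurableSpace G] [BorelSpace G], IsCompactSimpleLieGroup G →
      ∀ (r : LatticeRep G) (sch : SpeciesScheme (YMSpecies G)) (S₁ : SchwingerFamily E4),
        W1 r sch S₁ → EightFrameRP S₁ → PlanarCone S₁ →
        (∃ (K : E4 → ℝ) (C η : ℝ), 0 < η ∧ ContinuousOn K {x : E4 | x ≠ 0} ∧
          (∀ x : E4, x ≠ 0 → |K x| ≤ C * (1 + ‖x‖ ^ (η - 10))) ∧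
          ∀ F : 𝓢((Fin 2 → E4), ℂ), IsOffDiagonal F →
            Integrable (fun x : Fin 2 → E4 => (K (x 0 - x 1) : ℂ) * F x) ∧
              S₁ 2 F = ∫ x : Fin 2 → E4, (K (x 0 - x 1) : ℂ) * F x) →
        ∀ (R : E4 ≃ₗᵢ[ℝ] E4),
          (∀ x : E4, R x 0 = Real.cos (Real.pi / 4) * x 0 + Real.sin (Real.pi / 4) * x 1 ∧
            R x 1 = -Real.sin (Real.pi / 4) * x 0 + Real.cos (Real.pi / 4) * x 1 ∧
            R x 2 = x 2 ∧ R x 3 = x 3) →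
        OSReconstructionNoE1 (SchwingerFamily.toLabelled (fun n => (S₁ n).comp (linActMulti R))) →
        ∃ μ C : ℝ, μ < 4 ∧ 0 ≤ C ∧
          ∀ (u v : ℝ), 0 < u → 0 < v → u ≤ 1 → v ≤ 1 →
            ∀ (f₁ : 𝓢((Fin 1 → E4), ℂ)) (g hh : ℝ × ℝ → ℂ) (Mg Mh Mh' : ℝ),
              (∀ x : Fin 1 → E4, f₁ x = g (x 0 0, x 0 1) * hh (x 0 2, x 0 3)) →
              (∀ p : ℝ × ℝ, g p ≠ 0 → u ≤ p.1 ∧ p.1 ≤ 2 * u) →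
              Integrable g → (∫ p, ‖g p‖) ≤ Mg → Integrable hh → (∫ p, ‖hh p‖) ≤ Mh →
              (∀ p, ‖hh p‖ ≤ Mh') →
            ∀ (n : ℕ) (W : 𝓢((Fin n → E4), ℂ)), IsTimeOrdered W →
              IsTimeOrdered (f₁.appendTensor (translateMulti ((2 * u + v) • EuclideanSpace.single 0 1) W)) →
            ∀ (P : (Σ m : ℕ, 𝓢((Fin m → E4), ℂ)) → (Σ m : ℕ, 𝓢((Fin m → E4), ℂ))),
              (P = fun Gσ => ⟨1 + (1 + Gσ.1), translateMulti ((2 * u + v) • EuclideanSpace.single 0 1)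
                ((osAdjoint f₁).appendTensor
                  (f₁.appendTensor (translateMulti ((2 * u + v) • EuclideanSpace.single 0 1) Gσ.2)))⟩) →
            ∀ N : ℕ,
              (S₁ (n + (P^[N] ⟨n, W⟩).1)
                (linActMulti R ((osAdjoint W).appendTensor (P^[N] ⟨n, W⟩).2))).re ≤
                (S₁ (n + n) (linActMulti R ((osAdjoint W).appendTensor W))).re *
                  (C * Mg * (Mh + Mh') * (u ^ (-μ) + v ^ (-μ))) ^ (2 * N)) :
    Summit.QuantumFields.YangMills.Theses.IsotropyFromPowerCounting.CurvatureSandwichBound := by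
  intro G _ _ _ _ _ _ hG r sch S₁ hW1 h8 hC hK
  refine ⟨fun h => ?_, fun R hR h' => ?_⟩
  · obtain ⟨μ, C, hμ, hC0, hrow⟩ := hAxis G hG r sch S₁ hW1 h8 hC hK h
    refine ⟨μ, C, hμ, ?_⟩
    intro u v hu hv hu1 hv1 f₁ g hh Mg Mh Mh' hf₁ hg hgi hMg hhi hMh hMh' n W hW hFW
    have hCW := hrow u v hu hv hu1 hv1 f₁ g hh Mg Mh Mh' hf₁ hg hgi hMg hhi hMh hMh' n W hW hFW _ rfl
    exact sandwich_of_chainGrowth S₁ h u v hu hv f₁ (tsupport_subset_window hf₁ hg) _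
      (pairScale_nonneg hC0 hu hv hMg hMh hMh') W hW hFW _
      ((re_pairing_self_eq_norm_sq S₁ h W hW).symm ▸ sq_nonneg _) _ rfl hCW
  · obtain ⟨μ, C, hμ, hC0, hrow⟩ := hDiag G hG r sch S₁ hW1 h8 hC hK R hR h'
    refine ⟨μ, C, hμ, ?_⟩
    intro u v hu hv hu1 hv1 f₁ g hh Mg Mh Mh' hf₁ hg hgi hMg hhi hMh hMh' n W hW hFW
    have hCW := hrow u v hu hv hu1 hv1 f₁ g hh Mg Mh Mh' hf₁ hg hgi hMg hhi hMh hMh' n W hW hFW _ rfl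
    exact sandwich_of_chainGrowth (fun m => (S₁ m).comp (linActMulti R)) h' u v hu hv f₁
      (tsupport_subset_window hf₁ hg) _ (pairScale_nonneg hC0 hu hv hMg hMh hMh') W hW hFW _
      ((re_pairing_self_eq_norm_sq (fun m => (S₁ m).comp (linActMulti R)) h' W hW).symm ▸ sq_nonneg _)
      _ rfl hCW


/-- **Equivalence, axis frame**: the crux implies `stub_chainGrowthAxis` (with `C_W = ‖Ψ_W‖²`). -/
theorem chainGrowthAxis_of_crux
    (hcrux : Summit.QuantumFields.YangMills.Theses.IsotropyFromPowerCounting.CurvatureSandwichBound) :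
    ∀ (G : Type) [Group G] [TopologicalSpace G] [IsTopologicalGroup G] [CompactSpace G]
      [MeasurableSpace G] [BorelSpace G], IsCompactSimpleLieGroup G →
    ∀ (r : LatticeRep G) (sch : SpeciesScheme (YMSpecies G)) (S₁ : SchwingerFamily E4),
      W1 r sch S₁ → EightFrameRP S₁ → PlanarCone S₁ →
      (∃ (K : E4 → ℝ) (C η : ℝ), 0 < η ∧ ContinuousOn K {x : E4 | x ≠ 0} ∧
        (∀ x : E4, x ≠ 0 → |K x| ≤ C * (1 + ‖x‖ ^ (η - 10))) ∧
        ∀ F : 𝓢((Fin 2 → E4), ℂ), IsOffDiagonal F →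
          Integrable (fun x : Fin 2 → E4 => (K (x 0 - x 1) : ℂ) * F x) ∧
            S₁ 2 F = ∫ x : Fin 2 → E4, (K (x 0 - x 1) : ℂ) * F x) →
      OSReconstructionNoE1 S₁.toLabelled →
      ∃ μ C : ℝ, μ < 4 ∧ 0 ≤ C ∧
        ∀ (u v : ℝ), 0 < u → 0 < v → u ≤ 1 → v ≤ 1 →
          ∀ (f₁ : 𝓢((Fin 1 → E4), ℂ)) (g hh : ℝ × ℝ → ℂ) (Mg Mh Mh' : ℝ),
            (∀ x : Fin 1 → E4, f₁ x = g (x 0 0, x 0 1) * hh (x 0 2, x 0 3)) →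
            (∀ p : ℝ × ℝ, g p ≠ 0 → u ≤ p.1 ∧ p.1 ≤ 2 * u) →
            Integrable g → (∫ p, ‖g p‖) ≤ Mg → Integrable hh → (∫ p, ‖hh p‖) ≤ Mh →
            (∀ p, ‖hh p‖ ≤ Mh') →
          ∀ (n : ℕ) (W : 𝓢((Fin n → E4), ℂ)), IsTimeOrdered W →
            IsTimeOrdered (f₁.appendTensor (translateMulti ((2 * u + v) • EuclideanSpace.single 0 1) W)) →
          ∀ (P : (Σ m : ℕ, 𝓢((Fin m → E4), ℂ)) → (Σ m : ℕ, 𝓢((Fin m → E4), ℂ))),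
            (P = fun Gσ => ⟨1 + (1 + Gσ.1), translateMulti ((2 * u + v) • EuclideanSpace.single 0 1)
              ((osAdjoint f₁).appendTensor
                (f₁.appendTensor (translateMulti ((2 * u + v) • EuclideanSpace.single 0 1) Gσ.2)))⟩) →
          ∀ N : ℕ,
            (S₁ (n + (P^[N] ⟨n, W⟩).1) ((osAdjoint W).appendTensor (P^[N] ⟨n, W⟩).2)).re ≤
              (S₁ (n + n) ((osAdjoint W).appendTensor W)).re *
                (C * Mg * (Mh + Mh') * (u ^ (-μ) + v ^ (-μ))) ^ (2 * N) := by
  intro G _ _ _ _ _ _ hG r sch S₁ hW1 h8 hC hK h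
  obtain ⟨μ, C, hμ, hrow⟩ := (hcrux G hG r sch S₁ hW1 h8 hC hK).1 h
  refine ⟨μ, max C 0, hμ, le_max_right _ _, ?_⟩
  intro u v hu hv hu1 hv1 f₁ g hh Mg Mh Mh' hf₁ hg hgi hMg hhi hMh hMh' n W hW hFW P hP N
  rw [re_pairing_self_eq_norm_sq S₁ h W hW]
  have hΛ := pairScale_nonneg (μ := μ) (le_max_right C 0) hu hv hMg hMh hMh'
  refine chainGrowth_of_sandwich S₁ h u v hu hv f₁ (tsupport_subset_window hf₁ hg) _ hΛ
    (fun m G' hG' hXG' => ?_) P hP W hW hFW N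
  refine (hrow u v hu hv hu1 hv1 f₁ g hh Mg Mh Mh' hf₁ hg hgi hMg hhi hMh hMh' m G' hG' hXG').trans ?_
  have hrest : 0 ≤ Mg * (Mh + Mh') * (u ^ (-μ) + v ^ (-μ)) * ‖h.fieldVec m (fun _ => ()) G' hG'‖ := by
    have := pairScale_nonneg (μ := μ) (le_refl (0 : ℝ)).ge hu hv hMg hMh hMh'
    have hMg0 : 0 ≤ Mg := (integral_nonneg fun _ => norm_nonneg _).trans hMg
    have hMh0 : 0 ≤ Mh := (integral_nonneg fun _ => norm_nonneg _).trans hMh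
    have hMh'0 : 0 ≤ Mh' := (norm_nonneg _).trans (hMh' 0)
    have hr : 0 ≤ u ^ (-μ) + v ^ (-μ) :=
      add_nonneg (Real.rpow_nonneg hu.le _) (Real.rpow_nonneg hv.le _)
    positivity
  calc C * Mg * (Mh + Mh') * (u ^ (-μ) + v ^ (-μ)) * ‖h.fieldVec m (fun _ => ()) G' hG'‖
      = C * (Mg * (Mh + Mh') * (u ^ (-μ) + v ^ (-μ)) * ‖h.fieldVec m (fun _ => ()) G' hG'‖) := by ring
    _ ≤ max C 0 * (Mg * (Mh + Mh') * (u ^ (-μ) + v ^ (-μ)) * ‖h.fieldVec m (fun _ => ()) G' hG'‖) :=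
        mul_le_mul_of_nonneg_right (le_max_left _ _) hrest
    _ = max C 0 * Mg * (Mh + Mh') * (u ^ (-μ) + v ^ (-μ)) * ‖h.fieldVec m (fun _ => ()) G' hG'‖ := by ring

/-- **Equivalence, `45°` frame**: the crux implies `stub_chainGrowthDiag` (with `C_W = ‖Ψ'_W‖²`). -/
theorem chainGrowthDiag_of_crux
    (hcrux : Summit.QuantumFields.YangMills.Theses.IsotropyFromPowerCounting.CurvatureSandwichBound) :
    ∀ (G : Type) [Group G] [TopologicalSpace G] [IsTopologicalGroup G] [CompactSpace G]
      [MeasurableSpace G] [BorelSpace G], IsCompactSimpleLieGroup G →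
    ∀ (r : LatticeRep G) (sch : SpeciesScheme (YMSpecies G)) (S₁ : SchwingerFamily E4),
      W1 r sch S₁ → EightFrameRP S₁ → PlanarCone S₁ →
      (∃ (K : E4 → ℝ) (C η : ℝ), 0 < η ∧ ContinuousOn K {x : E4 | x ≠ 0} ∧
        (∀ x : E4, x ≠ 0 → |K x| ≤ C * (1 + ‖x‖ ^ (η - 10))) ∧
        ∀ F : 𝓢((Fin 2 → E4), ℂ), IsOffDiagonal F →
          Integrable (fun x : Fin 2 → E4 => (K (x 0 - x 1) : ℂ) * F x) ∧
            S₁ 2 F = ∫ x : Fin 2 → E4, (K (x 0 - x 1) : ℂ) * F x) →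
      ∀ (R : E4 ≃ₗᵢ[ℝ] E4),
        (∀ x : E4, R x 0 = Real.cos (Real.pi / 4) * x 0 + Real.sin (Real.pi / 4) * x 1 ∧
          R x 1 = -Real.sin (Real.pi / 4) * x 0 + Real.cos (Real.pi / 4) * x 1 ∧
          R x 2 = x 2 ∧ R x 3 = x 3) →
      OSReconstructionNoE1 (SchwingerFamily.toLabelled (fun n => (S₁ n).comp (linActMulti R))) →
      ∃ μ C : ℝ, μ < 4 ∧ 0 ≤ C ∧
        ∀ (u v : ℝ), 0 < u → 0 < v → u ≤ 1 → v ≤ 1 →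
          ∀ (f₁ : 𝓢((Fin 1 → E4), ℂ)) (g hh : ℝ × ℝ → ℂ) (Mg Mh Mh' : ℝ),
            (∀ x : Fin 1 → E4, f₁ x = g (x 0 0, x 0 1) * hh (x 0 2, x 0 3)) →
            (∀ p : ℝ × ℝ, g p ≠ 0 → u ≤ p.1 ∧ p.1 ≤ 2 * u) →
            Integrable g → (∫ p, ‖g p‖) ≤ Mg → Integrable hh → (∫ p, ‖hh p‖) ≤ Mh →
            (∀ p, ‖hh p‖ ≤ Mh') →
          ∀ (n : ℕ) (W : 𝓢((Fin n → E4), ℂ)), IsTimeOrdered W →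
            IsTimeOrdered (f₁.appendTensor (translateMulti ((2 * u + v) • EuclideanSpace.single 0 1) W)) →
          ∀ (P : (Σ m : ℕ, 𝓢((Fin m → E4), ℂ)) → (Σ m : ℕ, 𝓢((Fin m → E4), ℂ))),
            (P = fun Gσ => ⟨1 + (1 + Gσ.1), translateMulti ((2 * u + v) • EuclideanSpace.single 0 1)
              ((osAdjoint f₁).appendTensor
                (f₁.appendTensor (translateMulti ((2 * u + v) • EuclideanSpace.single 0 1) Gσ.2)))⟩) →
          ∀ N : ℕ,
            (S₁ (n + (P^[N] ⟨n, W⟩).1)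
              (linActMulti R ((osAdjoint W).appendTensor (P^[N] ⟨n, W⟩).2))).re ≤
              (S₁ (n + n) (linActMulti R ((osAdjoint W).appendTensor W))).re *
                (C * Mg * (Mh + Mh') * (u ^ (-μ) + v ^ (-μ))) ^ (2 * N) := by
  intro G _ _ _ _ _ _ hG r sch S₁ hW1 h8 hC hK R hR h'
  obtain ⟨μ, C, hμ, hrow⟩ := (hcrux G hG r sch S₁ hW1 h8 hC hK).2 R hR h'
  refine ⟨μ, max C 0, hμ, le_max_right _ _, ?_⟩
  intro u v hu hv hu1 hv1 f₁ g hh Mg Mh Mh' hf₁ hg hgi hMg hhi hMh hMh' n W hW hFW P hP N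
  have hre := re_pairing_self_eq_norm_sq (fun m => (S₁ m).comp (linActMulti R)) h' W hW
  simp only [ContinuousLinearMap.comp_apply] at hre
  rw [hre]
  have hΛ := pairScale_nonneg (μ := μ) (le_max_right C 0) hu hv hMg hMh hMh'
  refine chainGrowth_of_sandwich (fun m => (S₁ m).comp (linActMulti R)) h' u v hu hv f₁
    (tsupport_subset_window hf₁ hg) _ hΛ (fun m G' hG' hXG' => ?_) P hP W hW hFW N
  refine (hrow u v hu hv hu1 hv1 f₁ g hh Mg Mh Mh' hf₁ hg hgi hMg hhi hMh hMh' m G' hG' hXG').trans ?_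
  have hrest : 0 ≤ Mg * (Mh + Mh') * (u ^ (-μ) + v ^ (-μ)) * ‖h'.fieldVec m (fun _ => ()) G' hG'‖ := by
    have hMg0 : 0 ≤ Mg := (integral_nonneg fun _ => norm_nonneg _).trans hMg
    have hMh0 : 0 ≤ Mh := (integral_nonneg fun _ => norm_nonneg _).trans hMh
    have hMh'0 : 0 ≤ Mh' := (norm_nonneg _).trans (hMh' 0)
    have hr : 0 ≤ u ^ (-μ) + v ^ (-μ) :=
      add_nonneg (Real.rpow_nonneg hu.le _) (Real.rpow_nonneg hv.le _)
    positivity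
  calc C * Mg * (Mh + Mh') * (u ^ (-μ) + v ^ (-μ)) * ‖h'.fieldVec m (fun _ => ()) G' hG'‖
      = C * (Mg * (Mh + Mh') * (u ^ (-μ) + v ^ (-μ)) * ‖h'.fieldVec m (fun _ => ()) G' hG'‖) := by ring
    _ ≤ max C 0 * (Mg * (Mh + Mh') * (u ^ (-μ) + v ^ (-μ)) * ‖h'.fieldVec m (fun _ => ()) G' hG'‖) :=
        mul_le_mul_of_nonneg_right (le_max_left _ _) hrest
    _ = max C 0 * Mg * (Mh + Mh') * (u ^ (-μ) + v ^ (-μ)) * ‖h'.fieldVec m (fun _ => ()) G' hG'‖ := by ring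

end Summit.QuantumFields.YangMills.Theorems.CurvatureSandwichBound.Sketch

end
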